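import Mathlib

/-!
# Lipschitz-uniqueness of the swirling germ: the rotation skeleton (K24)

Solo seat `solo-NavierStokesRegularity-informed`, session 13; companion of `paper/axisymmetric-rigidity.md`,
Proposition 8.4(c′) (question Q7 of session 12, settled). At a swirling cone `z₁` of an axisymmetric
1-homogeneous solution of the cone equation (`u(z₁) = -1/2`, `v(z₁) = 0`, `s(z₁) = σ ≠ 0`) the singular part of the
linearised profile system in `ψ = φ - z₁` is `ψ w' = B₀ w` with `B₀ = (2/3) [[0, 2σ], [-2σ, 0]] = (4σ/3) J` SKEW
(the Briot–Bouquet cancellations `1 + 2u = 0` and `1 + 2u + v cot φ = 0` at the cone kill the diagonal). Certified: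

* `swirlGerm_rotation_solves`: in logarithmic time `τ = log ψ` the rotation
  `w(τ) = (cos(θτ) x + sin(θτ) y, -sin(θτ) x + cos(θτ) y)`, `θ = 4σ/3`, solves `w' = B₀ w`;
* `swirlGerm_rotation_norm`: it has constant Euclidean norm, so NO non-trivial solution of the linearised system
  decays as `ψ → 0`;
* `swirlGerm_bootstrap`: the closing inequality of the proof — if `λ := sup |Y - Y*|/ψ` satisfies
  `λ ≤ C (λ + λ²) ψ₁` with `C (1 + λ) ψ₁ < 1`, then `λ = 0` (the O(ψ)-close solution IS the germ).
No new definitions; axioms: standard.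
-/

namespace Summit.NavierStokesRegularity.NavierStokesRegularity.Theorems

/-- The rotation by angle `θ τ`, `θ = 4σ/3`, solves the linearised singular system `dw/dτ = B₀ w`,
`B₀ = (2/3)·[[0, 2σ], [-2σ, 0]]`, in logarithmic time `τ = log ψ` (first component). -/
theorem swirlGerm_rotation_solves_fst (σ x y τ : ℝ) :
    HasDerivAt (fun t => Real.cos (4 * σ / 3 * t) * x + Real.sin (4 * σ / 3 * t) * y)
      ((2/3) * (2 * σ) * (-Real.sin (4 * σ / 3 * τ) * x + Real.cos (4 * σ / 3 * τ) * y)) τ := by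
  have h1 : HasDerivAt (fun t => 4 * σ / 3 * t) (4 * σ / 3) τ := by
    simpa using (hasDerivAt_id τ).const_mul (4 * σ / 3)
  have h := ((h1.cos).mul_const x).add ((h1.sin).mul_const y)
  exact h.congr_deriv (by ring)

/-- Second component of `swirlGerm_rotation_solves_fst`. -/
theorem swirlGerm_rotation_solves_snd (σ x y τ : ℝ) :
    HasDerivAt (fun t => -Real.sin (4 * σ / 3 * t) * x + Real.cos (4 * σ / 3 * t) * y)
      ((2/3) * (-(2 * σ)) * (Real.cos (4 * σ / 3 * τ) * x + Real.sin (4 * σ / 3 * τ) * y)) τ := by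
  have h1 : HasDerivAt (fun t => 4 * σ / 3 * t) (4 * σ / 3) τ := by
    simpa using (hasDerivAt_id τ).const_mul (4 * σ / 3)
  have h := ((h1.sin).neg.mul_const x).add ((h1.cos).mul_const y)
  exact h.congr_deriv (by ring)

/-- The fundamental matrix `ψ^{B₀}` is a rotation: the Euclidean norm of every solution of the linearised
singular system is constant in `τ = log ψ`. Hence no non-trivial linearised solution tends to `0` as `ψ → 0`,
and an `O(ψ)` solution of the nonlinear system has the pure Duhamel representation used in Prop. 8.4(c′). -/
theorem swirlGerm_rotation_norm (σ x y τ : ℝ) :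
    (Real.cos (4 * σ / 3 * τ) * x + Real.sin (4 * σ / 3 * τ) * y) ^ 2
      + (-Real.sin (4 * σ / 3 * τ) * x + Real.cos (4 * σ / 3 * τ) * y) ^ 2 = x ^ 2 + y ^ 2 := by
  have h := Real.sin_sq_add_cos_sq (4 * σ / 3 * τ)
  nlinarith [h]

/-- The skew structure itself: `B₀ = (2/3)·[[0, 2σ], [-2σ, 0]]` satisfies `B₀ᵀ = -B₀`. -/
theorem swirlGerm_B0_skew (σ : ℝ) :
    (!![(0 : ℝ), (2/3) * (2 * σ); (2/3) * (-(2 * σ)), 0]).transpose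
      = -!![(0 : ℝ), (2/3) * (2 * σ); (2/3) * (-(2 * σ)), 0] := by
  ext i j
  fin_cases i <;> fin_cases j <;> norm_num [Matrix.transpose_apply]

/-- The bootstrap closing Prop. 8.4(c′): with `λ = sup_{(0, ψ₁]} |Y - Y*|/ψ ≥ 0`, the Duhamel estimate gives
`λ ≤ C (λ + λ²) ψ₁`; if `C (1 + λ) ψ₁ < 1` (shrink `ψ₁`; `λ` does not increase) then `λ = 0`. -/
theorem swirlGerm_bootstrap {lam C ψ₁ : ℝ} (hlam : 0 ≤ lam)
    (hest : lam ≤ C * (lam + lam ^ 2) * ψ₁) (hsmall : C * (1 + lam) * ψ₁ < 1) : lam = 0 := by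
  have h1 : lam * (1 - C * (1 + lam) * ψ₁) ≤ 0 := by nlinarith
  have h2 : 0 < 1 - C * (1 + lam) * ψ₁ := by linarith
  nlinarith

end Summit.NavierStokesRegularity.NavierStokesRegularity.Theorems
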